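import Summits.ValiantsHypothesis.ValiantsHypothesis.Theses.GirthSidon
import Summits.ValiantsHypothesis.ValiantsHypothesis.Theorems.GirthSidonMomentCurveDefinableCircuit
import Summits.ValiantsHypothesis.ValiantsHypothesis.Theorems.GirthSidonMomentCurveDefinableWitness

/-!
# Item `MomentCurveDefinable` (route GirthSidon): the multilinearised moment curve is poly(n)-definable

Closes item `stmt-ValiantsHypothesis-6544` of route `route-ValiantsHypothesis-GirthSidon`:
`momentCurveDefinable_proof : …Theses.GirthSidon.MomentCurveDefinable`, i.e. the family
`f n i = ∏_{j<n} (x_j if bit_j(E_n(i)) = 1 else 1)`, `E_n(i) = ∑_{k<60} (i+1)^k m^{60k}`,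
`m = m(n) = 2^{10⌊n/36000⌋}`, `i < m`, is `IsPolyDefinableMap` over `ℂ` (Raz 2010, Def. 1.3).

Proof (Raz 2010, remark after Def. 1.3 — "if the `{0,1}` coefficients of a multilinear mapping
are computable in polynomial time then the mapping is poly(n)-definable" — made explicit through
Valiant's criterion, Bürgisser 2000, Prop. 2.20): with `K = ⌈log₂ m⌉ = 10⌊n/36000⌋` the bits of
`E_n(i)` are computed from the bits of `i` by a `B₂`-program of size `momentSize K n = poly(n)`
(`GirthSidonBitDef.cktSize_momentBits`, file `…Circuit`); the transcript witness
`G = VALID · ∏_j (1 + W_j (x_j - 1))` of that program (`GirthSidonBitDef.BitDatum.G`, file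
`…Witness`) has `∑_e G(x, e, bits i) = f n i` (`BitDatum.boolSum_aeval_G`), `ℓ(n)` = number of
gates, `deg ≤ 3ℓ + 2n`, `L ≤ 60ℓ + 4n + 1`, all p-bounded. The index `n = 0` (no coordinates to
select, `f 0 0 = 1`) takes the witness `G = 1`.
-/

-- D-0017 layout `Summit.<Summit>.<Sub>.Theorems` with Sub = Summit: the duplicated component is intended.
set_option linter.dupNamespace false

namespace Summit.ValiantsHypothesis.ValiantsHypothesis.Theorems

open MvPolynomial Literature.Computability.AlgebraicComplexity Literature.Computability.Complexity
  Literature.Computability.Complexity.ArithCkt GirthSidonBitDef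

/-- `n ↦ 10 ⌊n / 36000⌋` is p-bounded. [folklore] -/
theorem isPBounded_ten_mul_div : IsPBounded fun n : ℕ => 10 * (n / 36000) :=
  (IsPBounded.mul_holds (IsPBounded.const 10) IsPBounded.id).mono fun n =>
    Nat.mul_le_mul_left 10 (Nat.div_le_self n 36000)

/-- The gate budget `momentBitSize` is p-bounded in `K`. [folklore] -/
theorem isPBounded_momentBitSize : IsPBounded momentBitSize := by
  have c := fun m : ℕ => IsPBounded.const m
  have h60 : IsPBounded fun K : ℕ => 60 * K := IsPBounded.mul_holds (c 60) IsPBounded.id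
  have hstep : IsPBounded mulStepSize := by
    unfold mulStepSize addSize
    exact IsPBounded.add_holds (IsPBounded.add_holds IsPBounded.id IsPBounded.id)
      (IsPBounded.add_holds (IsPBounded.mul_holds (c 73)
        (IsPBounded.add_holds IsPBounded.id IsPBounded.id)) (c 1))
  have hpow : IsPBounded powStepSize := by
    unfold powStepSize
    exact IsPBounded.add_holds (c 0) (IsPBounded.add_holds (IsPBounded.mul_holds h60
      (IsPBounded.comp_holds hstep h60)) (c 1))
  have hinit : IsPBounded powInitSize := by
    unfold powInitSize addSize
    exact IsPBounded.add_holds (IsPBounded.add_holds IsPBounded.id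
      (IsPBounded.add_holds (IsPBounded.mul_holds (c 73) IsPBounded.id) (c 1))) (c 2)
  unfold momentBitSize
  exact IsPBounded.add_holds (IsPBounded.add_holds hinit (IsPBounded.mul_holds (c 59) hpow)) (c 1)

/-- The gate budget of the bit map along the route's parameters `K = ⌈log₂ 2^{10 q}⌉`,
`q = ⌊n / 36000⌋`, is p-bounded in `n`. [folklore] -/
theorem isPBounded_momentSize :
    IsPBounded fun n : ℕ => momentSize (Nat.clog 2 (2 ^ (10 * (n / 36000)))) n := by
  have h : IsPBounded fun n : ℕ => n * momentBitSize (10 * (n / 36000)) :=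
    IsPBounded.mul_holds IsPBounded.id (IsPBounded.comp_holds isPBounded_momentBitSize
      isPBounded_ten_mul_div)
  refine h.mono fun n => le_of_eq ?_
  simp only [momentSize, Nat.clog_pow 2 _ one_lt_two]

/-- **Item `MomentCurveDefinable` (route GirthSidon)**: the multilinearised B₃₀ power-sum
moment curve, indexed by Raz's `n` with `m(n) = 2^{10 ⌊n/36000⌋}`, is poly(`n`)-definable over
`ℂ` in the sense of Raz 2010, Def. 1.3 (`IsPolyDefinableMap`). Proof: Raz's remark after
Def. 1.3 made explicit — the bits of the exponent `E(i) = ∑_{k<60} (i+1)^k m^{60k}` are computed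
from the bits of `i` by a polynomial-size `B₂`-program (`cktSize_momentBits`), and Valiant's
criterion over its transcript arithmetisation (`BitDatum.boolSum_aeval_G`) gives the Def. 1.3
witness with `ℓ(n)` = number of gates, degree `≤ 3ℓ + 2n` and complexity `≤ 60ℓ + 4n + 1`.
[folklore] -/
theorem momentCurveDefinable_proof :
    Summit.ValiantsHypothesis.ValiantsHypothesis.Theses.GirthSidon.MomentCurveDefinable := by
  unfold Summit.ValiantsHypothesis.ValiantsHypothesis.Theses.GirthSidon.MomentCurveDefinable
  -- the witness at each index `n`
  have key : ∀ n : ℕ, ∃ (L : ℕ)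
      (G : MvPolynomial ((Fin n ⊕ Fin L) ⊕ Fin (Nat.clog 2 (2 ^ (10 * (n / 36000))))) ℂ),
      L ≤ momentSize (Nat.clog 2 (2 ^ (10 * (n / 36000)))) n ∧
      complexity G ≤ 60 * L + 4 * n + 1 ∧ G.totalDegree ≤ 3 * L + 2 * n ∧
      ∀ i : Fin (2 ^ (10 * (n / 36000))),
        (∏ j : Fin n, (if Nat.testBit (∑ k ∈ Finset.range 60,
            ((i : ℕ) + 1) ^ k * (2 ^ (10 * (n / 36000))) ^ (60 * k)) j
            then (MvPolynomial.X j : MvPolynomial (Fin n) ℂ) else 1)) =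
          boolSum (bitSubst (σ := fun n => Fin n) n L (Nat.clog 2 (2 ^ (10 * (n / 36000)))) i G) := by
    intro n
    have hK : Nat.clog 2 (2 ^ (10 * (n / 36000))) = 10 * (n / 36000) := Nat.clog_pow 2 _ one_lt_two
    obtain ⟨gs, out, hlen, hreal⟩ := cktSize_momentBits (Nat.clog 2 (2 ^ (10 * (n / 36000)))) n
    rcases Nat.eq_zero_or_pos n with hn | hn
    · subst hn
      refine ⟨0, 1, Nat.zero_le _, ?_, ?_, fun i => ?_⟩
      · rw [← C_1, complexity_C_holds]; exact Nat.zero_le _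
      · exact totalDegree_one.trans_le (Nat.zero_le _)
      · simp [boolSum, bitSubst]
    · let Λ : BitDatum := ⟨n, Nat.clog 2 (2 ^ (10 * (n / 36000))), hn, gs, out,
        momentBits (Nat.clog 2 (2 ^ (10 * (n / 36000)))) n, hreal⟩
      refine ⟨gs.length, Λ.G ℂ, hlen, Λ.complexity_G_le, Λ.totalDegree_G_le, fun i => ?_⟩
      have hi : (i : ℕ) < 2 ^ Nat.clog 2 (2 ^ (10 * (n / 36000))) := by rw [hK]; exact i.isLt
      refine Eq.trans ?_ (Λ.boolSum_aeval_G (k := ℂ) (i : ℕ)).symm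
      refine Finset.prod_congr rfl fun j _ => ?_
      have hD : Λ.D (fun t => (i : ℕ).testBit t) j =
          Nat.testBit (∑ k ∈ Finset.range 60,
            ((i : ℕ) + 1) ^ k * (2 ^ (10 * (n / 36000))) ^ (60 * k)) j := by
        show momentBits _ n _ j = _
        rw [momentBits, Nat.ofBits_testBit, Nat.mod_eq_of_lt hi, momentVal]
        refine congrArg (fun E : ℕ => E.testBit (j : ℕ)) ?_
        refine Finset.sum_congr rfl fun k _ => ?_
        rw [← pow_mul, hK]
        ring
      rw [hD]
  choose L G hL hC hD hG using key
  have hLp : IsPBounded L := isPBounded_momentSize.mono hL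
  refine ⟨L, G, hLp, ?_, ?_, fun n i => hG n i⟩
  · exact (IsPBounded.add_holds (IsPBounded.mul_holds (IsPBounded.const 3) hLp)
      (IsPBounded.mul_holds (IsPBounded.const 2) IsPBounded.id)).mono hD
  · exact (IsPBounded.add_holds (IsPBounded.add_holds (IsPBounded.mul_holds (IsPBounded.const 60) hLp)
      (IsPBounded.mul_holds (IsPBounded.const 4) IsPBounded.id)) (IsPBounded.const 1)).mono hC

end Summit.ValiantsHypothesis.ValiantsHypothesis.Theorems
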